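import Literature.AlgebraicGeometry.Frobenioids.BaseSectionsOfObjectsCor57iModelBirat
import Literature.AlgebraicGeometry.Frobenioids.BaseSectionsOfObjectsCor57NonVacuity
import HarnessLib

/-!
# Frobenioids I, Corollary 5.7 (i) "`C₁` is of model type iff `C₂` is" AT THE birationalizations, with NO
# residual hypothesis: all Frobenioids over bases of FSM-type, and the arithmetic Frobenioids `C_{K/F}`

Mochizuki, *The geometry of Frobenioids I: the general theory*, Kyushu J. Math. **62** (2008)
293–400, Cor. 5.7 (i) p. 108 ("In particular, `C₁` is of model type if and only if `C₂` is"), Def. 4.5 (i)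
p. 86, Thm. 6.4 p. 114 (the arithmetic Frobenioids of Ex. 6.3 satisfy the hypotheses of §5)
[cite: MochizukiFrdI2008, Cor. 5.7 (i) p.108].

PROOF-ONLY file (abc-iut cell, F fact-proving wave, seat abc-iut-f-022; FACT-LIST row F-0935
`PreFrobenioid.Cor57i_model`, instance forms). The faithful instance of the typed `Cor57i_model` — both
birationalization data THE birationalizations `PreFrobenioid.biratData` — is `cor57i_model_biratData_of`
(`BaseSectionsOfObjectsCor57iModelBirat.lean`), modulo the typed per-instance conclusions of [FrdI] Thm. 3.4
(ii), (iii) and Cor. 4.11 (ii) for `Ψ`, `Ψ⁻¹`. Over bases of FSM-type (the instance family the abc-iut cone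
cites — Galois categories and temperoids are of FSM-type) those inputs are theorems of the tree with no residual
binder: Thm. 3.4 (ii)/(iii) by seats abc-iut-L1-t13 / w4-d033 / w4-d086 (`thm34ii_inst_of_isOfFSMType`,
`FrdI.thm34iii_ofFunctor_of_isOfFSMType`) and Cor. 4.11 (ii) by seat abc-iut-L1-d6 through seat abc-iut-f-023's
`Cor57Hypotheses.cor411ii_of_isOfFSMType`. Hence:
* `cor57i_model_biratData_of_isOfFSMType` — the typed `Cor57i_model F₁ F₂ Ψ (biratData …) (biratData …)` for
  every equivalence `Ψ` of Frobenioids over FSM-type bases, NO residual hypothesis;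
* `cor57i_model_arith_biratData`, `isOfModelType_iff_arith` — the same at every equivalence
  `Ψ : C_{K₁/F₁} ⥲ C_{K₂/F₂}` of arithmetic Frobenioids (seat abc-iut-L1-d1's nonempty_genuine
  `cor57Hypotheses_arith`; bases `FinSubextCat` of FSM-type, seat abc-iut-L6-t10), in conclusion form:
  "`C_{K₁/F₁}` is of model type iff `C_{K₂/F₂}` is".
No new definition; no statement of the paper is restated or strengthened; nothing here bears on, or takes a
side on, [IUTchIII] Cor. 3.12.
-/

noncomputable section

namespace Literature.AlgebraicGeometry.Frobenioids

open CategoryTheory Opposite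

universe w v v' u u'

namespace PreFrobenioid

section FSM

variable {D₁ : Type u} [Category.{v} D₁] {Φ₁ : D₁ᵒᵖ ⥤ CommMonCat.{w}}
  {C₁ : Type u'} [Category.{v'} C₁] (F₁ : C₁ ⥤ ElemFrobenioid Φ₁)
  {D₂ : Type u} [Category.{v} D₂] {Φ₂ : D₂ᵒᵖ ⥤ CommMonCat.{w}}
  {C₂ : Type u'} [Category.{v'} C₂] (F₂ : C₂ ⥤ ElemFrobenioid Φ₂)

/-- **[FrdI] Cor. 5.7 (i) "`C₁` is of model type iff `C₂` is", AT THE birationalizations, over bases of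
FSM-type — NO residual hypothesis**: the typed `Cor57i_model F₁ F₂ Ψ (biratData hF₁ hsq₁) (biratData hF₂ hsq₂)`
for every equivalence `Ψ : C₁ ⥲ C₂` of Frobenioids over bases `D₁`, `D₂` of FSM-type (Thm. 3.4 (ii)/(iii) and
Cor. 4.11 (ii) being theorems of the tree over such bases). [cite: MochizukiFrdI2008, Cor. 5.7 (i) p.108] -/
theorem cor57i_model_biratData_of_isOfFSMType (hF₁ : IsFrobenioid F₁) (hF₂ : IsFrobenioid F₂)
    (hsq₁ : HasBiratSquares F₁) (hsq₂ : HasBiratSquares F₂) (Ψ : C₁ ≌ C₂)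
    (hD₁ : IsOfFSMType D₁) (hD₂ : IsOfFSMType D₂) :
    Cor57i_model F₁ F₂ Ψ (biratData hF₁ hsq₁) (biratData hF₂ hsq₂) := fun hyp =>
  cor57i_model_biratData_of F₁ F₂ hF₁ hF₂ hsq₁ hsq₂ Ψ
    (thm34ii_inst_of_isOfFSMType F₁ F₂ Ψ hF₁ hF₂ hD₁ hD₂)
    (thm34ii_inst_of_isOfFSMType F₂ F₁ Ψ.symm hF₂ hF₁ hD₂ hD₁)
    (FrdI.thm34iii_ofFunctor_of_isOfFSMType hF₁ hF₂ hD₁ hD₂ Ψ)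
    (FrdI.thm34iii_ofFunctor_of_isOfFSMType hF₂ hF₁ hD₂ hD₁ Ψ.symm)
    (hyp.cor411ii_of_isOfFSMType F₁ F₂ hD₁ hD₂) ((hyp.symm F₁ F₂).cor411ii_of_isOfFSMType F₂ F₁ hD₂ hD₁) hyp

/-- The same in conclusion form: under the hypotheses of Cor. 5.7, over FSM-type bases, `C₁` is of model type
(pre-model and birationally Frobenius-normalized at THE birationalization) iff `C₂` is.
[cite: MochizukiFrdI2008, Cor. 5.7 (i) p.108] -/
theorem isOfPreModelType_and_isOfBiratFrobeniusNormalizedType_iff_of_isOfFSMType {Ψ : C₁ ≌ C₂}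
    (hyp : Cor57Hypotheses F₁ F₂ Ψ) (hsq₁ : HasBiratSquares F₁) (hsq₂ : HasBiratSquares F₂)
    (hD₁ : IsOfFSMType D₁) (hD₂ : IsOfFSMType D₂) :
    (IsOfPreModelType F₁ ∧
        PreFrobenioidData.IsOfBiratFrobeniusNormalizedType (biratData hyp.isFrobenioid₁ hsq₁)) ↔
      (IsOfPreModelType F₂ ∧
        PreFrobenioidData.IsOfBiratFrobeniusNormalizedType (biratData hyp.isFrobenioid₂ hsq₂)) :=
  (cor57i_model_biratData_of_isOfFSMType F₁ F₂ hyp.isFrobenioid₁ hyp.isFrobenioid₂ hsq₁ hsq₂ Ψ hD₁ hD₂ hyp).2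

end FSM

end PreFrobenioid

/-! ### At the arithmetic Frobenioids `C_{K/F}` (Ex. 6.3 / Thm. 6.4): genuine, binder-free instances -/

section Arith

open PreFrobenioid

variable {F₁ : Type} [Field F₁] [NumberField F₁] {K₁ : Type} [Field K₁] [Algebra F₁ K₁] [IsGalois F₁ K₁]
variable {F₂ : Type} [Field F₂] [NumberField F₂] {K₂ : Type} [Field K₂] [Algebra F₂ K₂] [IsGalois F₂ K₂]

/-- **[FrdI] Cor. 5.7 (i) "model type" AT every equivalence `Ψ : C_{K₁/F₁} ⥲ C_{K₂/F₂}` of arithmetic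
Frobenioids, at THE birationalizations** — the typed `Cor57i_model`, whose antecedent `Cor57Hypotheses` is
seat abc-iut-L1-d1's `cor57Hypotheses_arith Ψ` (nonempty_genuine). [cite: MochizukiFrdI2008, Cor. 5.7 (i) p.108] -/
theorem cor57i_model_arith_biratData (Ψ : arithFrobenioid F₁ K₁ ≌ arithFrobenioid F₂ K₂)
    (hsq₁ : HasBiratSquares
      (ModelFrobenioid.toElem (arithDivisorFunctor F₁ K₁) (unitsFunctor F₁ K₁) (divNatTrans F₁ K₁)))
    (hsq₂ : HasBiratSquares
      (ModelFrobenioid.toElem (arithDivisorFunctor F₂ K₂) (unitsFunctor F₂ K₂) (divNatTrans F₂ K₂))) :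
    Cor57i_model
      (ModelFrobenioid.toElem (arithDivisorFunctor F₁ K₁) (unitsFunctor F₁ K₁) (divNatTrans F₁ K₁))
      (ModelFrobenioid.toElem (arithDivisorFunctor F₂ K₂) (unitsFunctor F₂ K₂) (divNatTrans F₂ K₂)) Ψ
      (biratData (arithFrobenioid_isFrobenioid F₁ K₁) hsq₁)
      (biratData (arithFrobenioid_isFrobenioid F₂ K₂) hsq₂) :=
  cor57i_model_biratData_of_isOfFSMType _ _ _ _ hsq₁ hsq₂ Ψ (FinSubextCat.isOfFSMType F₁ K₁)
    (FinSubextCat.isOfFSMType F₂ K₂)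

/-- **"`C_{K₁/F₁}` is of model type iff `C_{K₂/F₂}` is"** for every equivalence `Ψ : C_{K₁/F₁} ⥲ C_{K₂/F₂}`
(conclusion form, no antecedent: `cor57Hypotheses_arith` discharges `Cor57Hypotheses`; model type =
pre-model type ∧ birationally Frobenius-normalized type at THE birationalization).
[cite: MochizukiFrdI2008, Cor. 5.7 (i) p.108] -/
theorem isOfModelType_iff_arith (Ψ : arithFrobenioid F₁ K₁ ≌ arithFrobenioid F₂ K₂)
    (hsq₁ : HasBiratSquares
      (ModelFrobenioid.toElem (arithDivisorFunctor F₁ K₁) (unitsFunctor F₁ K₁) (divNatTrans F₁ K₁)))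
    (hsq₂ : HasBiratSquares
      (ModelFrobenioid.toElem (arithDivisorFunctor F₂ K₂) (unitsFunctor F₂ K₂) (divNatTrans F₂ K₂))) :
    (IsOfPreModelType
          (ModelFrobenioid.toElem (arithDivisorFunctor F₁ K₁) (unitsFunctor F₁ K₁) (divNatTrans F₁ K₁)) ∧
        PreFrobenioidData.IsOfBiratFrobeniusNormalizedType
          (biratData (arithFrobenioid_isFrobenioid F₁ K₁) hsq₁)) ↔
      (IsOfPreModelType
          (ModelFrobenioid.toElem (arithDivisorFunctor F₂ K₂) (unitsFunctor F₂ K₂) (divNatTrans F₂ K₂)) ∧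
        PreFrobenioidData.IsOfBiratFrobeniusNormalizedType
          (biratData (arithFrobenioid_isFrobenioid F₂ K₂) hsq₂)) :=
  (cor57i_model_arith_biratData Ψ hsq₁ hsq₂ (cor57Hypotheses_arith F₁ K₁ F₂ K₂ Ψ)).2

end Arith

end Literature.AlgebraicGeometry.Frobenioids

end
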